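import Summits.BirchSwinnertonDyer.BirchSwinnertonDyer.Theses.AdditiveKolyvaginRoad
import Summits.BirchSwinnertonDyer.BirchSwinnertonDyer.Theorems.AdditiveKolyvaginRoadKolyvaginPrimitiveAdditiveRankLowering
import Summits.BirchSwinnertonDyer.BirchSwinnertonDyer.Theorems.AdditiveKolyvaginRoadKolyvaginPrimitiveAdditiveInduction
import Summits.BirchSwinnertonDyer.BirchSwinnertonDyer.Theorems.AdditiveKolyvaginRoadKolyvaginSupplyOfPoitouTate
import Summits.BirchSwinnertonDyer.BirchSwinnertonDyer.Theorems.AdditiveKolyvaginRoadKolyvaginPrimitiveAdditiveParityOfLevelInputs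
import HarnessLib

/-!
# Route `AdditiveKolyvaginRoad`: item `KolyvaginPrimitiveOfLevelSystemsAdditive` (stmt-BirchSwinnertonDyer-21266) —
# THE E-SIDE COMPOSITION: published inputs + published duality inputs + LEVEL SYSTEMS (KS) + BOTTOM (BOT) ⟹
# Kolyvagin's conjecture mod `p` at an additive prime (`KolyvaginPrimitiveAdditive`), at the frames with `d_K < −4`
# (cell `pub/bsd-wall`, lead prover `bsd-wall-akr-p1` g4)

WHAT. `kolyvaginPrimitiveAdditive_of_levelSystems_of_discr_lt`: the composition `KolyvaginPrimitiveAdditive_of` of the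
registered skeleton v8 of crux 20132 (line `birth`) with every stub DISCHARGED OR GRANTED BY NAME: parity P from PUB +
DUAL.1 (`oddSelmerRankAdditive_of_levelInputs`), `s = 1`: BOT + `kolSupp_one`, `s ≥ 3`: complex conjugation `c ≠ 1`,
the `ZMod p`-structures, A1 (`stub_rankLoweringAdditive`, p521749), KS (granted), LOC from DUAL.2 = Poitou–Tate
(`kolyvaginLocalPackageP_of_poitouTate`, akr-p1 g3/g4 port of W. Zhang's Lemma 8.2) and the ENGINE
(`stub_inductionOfLevelSystemsAdditive`, p534939). The conclusion is the text of `KolyvaginPrimitiveAdditive` with the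
binder `NumberField.discr K < -4` (the order `ℓ + 1` of the Kolyvagin character; route rev R-K4: KPA ∕ KS ∕ BOT carry it), i.e.
item 21266 VERBATIM: `kolyvaginPrimitiveOfLevelSystemsAdditive_proof`.

HONEST FRAMING: theorems only; 0 definitions, 0 named facts, 0 `sorry`; the item's statement IS the conditional (PUB, DUAL
published; KS, BOT the open promoted cruxes), nothing about them is asserted.

References: [cite: WZhang2014, §9 proof of Thm. 9.1, Thm. 9.2, Lemma 8.2] [cite: GrossLMS1991, §4, Prop. 2.3]
[cite: MilneADT2006, Ch. I, Thm. 4.10, §6 Thm. 6.13] [cite: McCallumLMS1991, Prop. 2.1].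
-/

-- single-conjunct summit: `Summit.BirchSwinnertonDyer.BirchSwinnertonDyer.…` repeats the name by design
set_option linter.dupNamespace false

noncomputable section

open scoped Classical

namespace Summit.BirchSwinnertonDyer.BirchSwinnertonDyer.Theorems.AdditiveKoly

open WeierstrassCurve NumberField IsDedekindDomain Field Literature.NumberTheory.EllipticCurves
  Literature.NumberTheory.EllipticCurves.ModularForms
  Literature.NumberTheory.EllipticCurves.Rank1Residual
  Literature.NumberTheory.GaloisRepresentations
  Summit.BirchSwinnertonDyer.Rank1Residual Module
open Summit.BirchSwinnertonDyer.BirchSwinnertonDyer.Theses.AdditiveKolyvaginRoad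

/-- Complex conjugation exists: an imaginary quadratic field has an automorphism `≠ 1` (`|Aut(K/ℚ)| = 2`). [folklore] -/
theorem exists_algEquiv_ne_one_of_isImaginaryQuadratic (K : Type) [Field K] [NumberField K]
    (hK : IsImaginaryQuadratic K) : ∃ c : K ≃ₐ[ℚ] K, c ≠ 1 := by
  haveI : Algebra.IsQuadraticExtension ℚ K := ⟨hK.1⟩
  have hcard : Nat.card (K ≃ₐ[ℚ] K) = 2 := by rw [IsGalois.card_aut_eq_finrank, hK.1]
  haveI : Finite (K ≃ₐ[ℚ] K) := Nat.finite_of_card_ne_zero (by rw [hcard]; decide)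
  haveI : Nontrivial (K ≃ₐ[ℚ] K) := Finite.one_lt_card_iff_nontrivial.mp (by rw [hcard]; decide)
  exact exists_ne 1

/-- **The E-side composition at the frames with `d_K < −4`**: granted the published inputs `PublishedInputsAdditiveKoly`,
the published duality inputs `PublishedDualityInputsAdditiveKoly` (levelwise Cassels–Tate, Poitou–Tate for Selmer
structures), the level systems `LevelKolyvaginSystemsAdditive` (KS) and the bottom `BottomRankOneAdditive` (BOT), every
♯ additive frame with `d_K < −4` has a Kolyvagin–Heegner datum of Kolyvagin-prime support with `c(1) ≠ 0` in
`H¹(K, E[p])`. Parity P ∕ A1 ∕ LOC ∕ ENGINE are tree theorems (this lineage); KS and BOT are the open cruxes.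
[cite: WZhang2014, §9 proof of Thm. 9.1, Thm. 9.2, Lemma 8.2] [cite: GrossLMS1991, §4, Prop. 2.3] -/
theorem kolyvaginPrimitiveAdditive_of_levelSystems_of_discr_lt (hPUB : PublishedInputsAdditiveKoly)
    (hDual : PublishedDualityInputsAdditiveKoly) (hKS : LevelKolyvaginSystemsAdditive) (hBOT : BottomRankOneAdditive) :
    ∀ (W : WeierstrassCurve ℚ) [W.IsElliptic] [W.IsGloballyMinimal] [NeZero (W.conductorNorm ℤ)]
      (p : ℕ) [Fact p.Prime] (K : Type) [Field K] [NumberField K]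
      (Dt : ModularParametrizationData W (W.conductorNorm ℤ)) (β : ℤ) (ι : K →+* ℂ),
      5 ≤ p → Addv W p → W.HasSurjectiveModNGaloisRep p →
      (∀ (ℓ : ℕ) [Fact ℓ.Prime], W.HasMultiplicativeReductionAtPrime ℓ →
        ¬ p ∣ padicValInt ℓ W.minimalDiscriminantInt) →
      (∃ (ℓ₁ ℓ₂ : ℕ) (_ : Fact ℓ₁.Prime) (_ : Fact ℓ₂.Prime), ℓ₁ ≠ ℓ₂ ∧
        W.HasMultiplicativeReductionAtPrime ℓ₁ ∧ W.HasMultiplicativeReductionAtPrime ℓ₂) →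
      ¬ p ∣ W.tamagawaProduct → W.analyticRank = 1 →
      IsImaginaryQuadratic K → Odd (NumberField.discr K) → NumberField.discr K < -4 →
      SatisfiesHeegnerHypothesis (W.conductorNorm ℤ) K →
      (W.quadraticTwist (NumberField.discr K : ℚ)).entireLFunction 1 ≠ 0 →
      (4 * (W.conductorNorm ℤ : ℤ)) ∣ β ^ 2 - NumberField.discr K → ¬ (p : ℤ) ∣ Dt.c →
      ∃ (n : ℕ) (d : KolyvaginHeegnerData Dt β ι n),
        KolyvaginDescent.KolSupp (Zhang2014.IsKolyvaginPrime (W.conductorNorm ℤ) W K p) n ∧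
          d.kolyvaginClass (Fact.out : p.Prime) 1 ≠ 0 := by
  intro W _ _ _ p _ K _ _ Dt β ι h5 hadd hsurj hsp1 hsp2 htam hr1 hK hodd hd hHH hL hβ hc
  have hp : p.Prime := Fact.out
  obtain ⟨s, hsodd, hs⟩ := oddSelmerRankAdditive_of_levelInputs hPUB.1 hPUB.2.1 hPUB.2.2.2.2.1 hDual.1 W p K Dt β ι
    h5 hadd hsurj hsp1 hsp2 htam hr1 hK hodd hHH hL hβ hc
  by_cases h1 : s = 1
  · -- the bottom: BOT with the pinned `n = 1` witness
    subst h1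
    rw [pow_one] at hs
    obtain ⟨d, hd1⟩ := hBOT W p K Dt β ι h5 hadd hsurj hsp1 hsp2 htam hr1 hK hodd hd hHH hL hβ hc hs
    exact ⟨1, d, KolyvaginDescent.kolSupp_one _, hd1⟩
  · -- Selmer rank odd and `≠ 1`, hence `≥ 3`: Zhang's induction above the bottom
    have h3 : 3 ≤ s := by
      obtain ⟨k, hk⟩ := hsodd
      omega
    have hp2 : p ≠ 2 := by omega
    obtain ⟨c, hc1⟩ := exists_algEquiv_ne_one_of_isImaginaryQuadratic K hK
    -- the unique `ZMod p`-module structures on `H¹(K, E[p])` and on the `H¹(K_v, E[p])`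
    letI : Module (ZMod p) (Vp W K p) :=
      AddCommGroup.zmodModule (fun x ↦ by
        have h := zsmul_discreteH1_torsion ((p ^ 1 : ℕ) : ℤ) x
        rw [← natCast_zsmul]
        convert h using 2
        push_cast
        ring)
    letI : ∀ v : Place K, Module (ZMod p)
        (galoisCohomology (((W.baseChange K).torsionGaloisModule ((p ^ 1 : ℕ) : ℤ)).toLocal v) 1) := fun v ↦
      AddCommGroup.zmodModule (fun x ↦ by
        have h := galoisCohomology.nsmul_eq_zero_of_forall
          (((W.baseChange K).torsionGaloisModule ((p ^ 1 : ℕ) : ℤ)).toLocal v) (n := p ^ 1)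
          (fun m => AddSubgroup.torsionBy.nsmul m) x
        simpa using h)
    -- cup products need compact absolute Galois groups; `E[p](K̄)` is finite
    haveI : NeZero (p ^ 1 : ℕ) := ⟨pow_ne_zero 1 hp.ne_zero⟩
    haveI : ∀ v : Place K, CompactSpace (absoluteGaloisGroup (Place.Completion v)) := fun v ↦
      absoluteGaloisGroup_compactSpace _
    haveI : Finite (geomTorsion (W.baseChange K) ((p ^ 1 : ℕ) : ℤ)) :=
      finite_geomTorsion_of_neZero (W.baseChange K) (p ^ 1)
    have hA1 := stub_rankLoweringAdditive W p K Dt β ι h5 hadd hsurj hsp1 hsp2 htam hr1 hK hodd hHH hL hβ hc c hc1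
    obtain ⟨S⟩ := hKS W p K Dt β ι h5 hadd hsurj hsp1 hsp2 htam hr1 hK hodd hd hHH hL hβ hc c hc1
    obtain ⟨L⟩ := kolyvaginLocalPackageP_of_poitouTate W K p ι c hK hp2 hd hsurj hc1 (hDual.2 K)
    exact stub_inductionOfLevelSystemsAdditive W p K Dt β ι h5 hadd hsurj hsp1 hsp2 htam hr1 hK hodd hHH hL hβ hc c
      hc1 hA1 S L s hsodd h3 hs

/-- **Item `KolyvaginPrimitiveOfLevelSystemsAdditive` (stmt-BirchSwinnertonDyer-21266), by name**: the E-side composition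
`PublishedInputsAdditiveKoly → PublishedDualityInputsAdditiveKoly → LevelKolyvaginSystemsAdditive → BottomRankOneAdditive →
KolyvaginPrimitiveAdditive`. [cite: WZhang2014, §9 proof of Thm. 9.1, Thm. 9.2, Lemma 8.2] -/
theorem kolyvaginPrimitiveOfLevelSystemsAdditive_proof : KolyvaginPrimitiveOfLevelSystemsAdditive :=
  fun hPUB hDual hKS hBOT ↦ kolyvaginPrimitiveAdditive_of_levelSystems_of_discr_lt hPUB hDual hKS hBOT

end Summit.BirchSwinnertonDyer.BirchSwinnertonDyer.Theorems.AdditiveKoly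

end
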